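import Literature.NumberTheory.LFunctions.SemimultiplicativeMoebiusChain
import Literature.NumberTheory.LFunctions.SemimultiplicativeMoebiusKatai
import HarnessLib

/-!
# Konieczny 2020, Proposition 6.3: global cancellation is controlled by local cancellation

Topic `Literature/NumberTheory/LFunctions`. Everything in this file is PROVED. For a unimodular
`q`-semimultiplicative `f` with gap `≤ r` (`r ≥ 1`) and a window `[K, K+L)` of digit positions,
write `Λ_{K,L}(f) = ‖q^{-L} ∑_{c<q^L} f(c q^K)‖` and `δ_{K,L} = 1 - Λ_{K,L}` (the paper's `λ_f^I`,
`1 - λ_f^I`, `I = [K, K+L)`).  We prove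

* `Konieczny.local_control` —
  `δ_{K,L}(f) ≤ 12 ∑_{K ≤ k < K+L} ∑_{1 ≤ l ≤ 2r} δ_{k,l}(f)`,

which is Proposition 6.3 of J. Konieczny, Monatsh. Math. 192 (2020) (arXiv:1808.06196, §6: "for
an interval `I` there are disjoint intervals `I_i ⊆ I` of length `≤ 2r` with
`ε_f^I ≪ ∑_i ε_f^{I_i}`"), in the `δ`-currency and with the sum simply extended over ALL
sub-windows of length `≤ 2r` (all terms are `≥ 0`).  Proof as printed: cut `[K, K+L)` into
consecutive blocks of `r` digits; by the chain identity (`Konieczny.chain_identity`, Lemma 3.5)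
`f` is the product of three "pair" products `P_0, P_1, P_2` and the conjugates of three "single"
products `Q_0, Q_1, Q_2` (blocks grouped by index mod `3`), each a product of functions of
DISJOINT digit blocks; `2δ = min_{|z|=1} 𝔼|f - z|²` (Lemma 6.1 in exact form),
`|f - Z| ≤ ∑_a |P_a - ζ_a| + ∑_a |Q_a - ξ_a|`, Cauchy–Schwarz with `6` terms, and independence of
digit blocks (`Konieczny.avg_prod_blocks`, Lemma 6.2) to evaluate `𝔼 P_a`, `𝔼 Q_a` as products
of window averages.
-/

noncomputable section

open Finset
open scoped ComplexConjugate

namespace Literature.NumberTheory.LFunctions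

namespace Konieczny

/-! ## Elementary inequalities -/

/-- `1 - ∏ x_i ≤ ∑ (1 - x_i)` for `x_i ∈ [0, 1]`. [folklore] -/
theorem one_sub_prod_le_sum {ι : Type*} [DecidableEq ι] (s : Finset ι) (x : ι → ℝ)
    (h0 : ∀ i ∈ s, 0 ≤ x i) (h1 : ∀ i ∈ s, x i ≤ 1) :
    1 - ∏ i ∈ s, x i ≤ ∑ i ∈ s, (1 - x i) := by
  induction s using Finset.induction_on with
  | empty => simp
  | insert a s ha ih =>
      rw [prod_insert ha, sum_insert ha]
      have ha0 : 0 ≤ x a := h0 a (mem_insert_self a s)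
      have ha1 : x a ≤ 1 := h1 a (mem_insert_self a s)
      have hP1 : ∏ i ∈ s, x i ≤ 1 := prod_le_one (fun i hi => h0 i (mem_insert_of_mem hi))
        (fun i hi => h1 i (mem_insert_of_mem hi))
      have hih := ih (fun i hi => h0 i (mem_insert_of_mem hi)) (fun i hi => h1 i (mem_insert_of_mem hi))
      nlinarith

/-- Distance of products of numbers of norm `≤ 1` is at most the sum of the distances.
[folklore] -/
theorem norm_prod_sub_prod_le {ι : Type*} [DecidableEq ι] (s : Finset ι) (a b : ι → ℂ)
    (ha : ∀ i ∈ s, ‖a i‖ ≤ 1) (hb : ∀ i ∈ s, ‖b i‖ ≤ 1) :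
    ‖∏ i ∈ s, a i - ∏ i ∈ s, b i‖ ≤ ∑ i ∈ s, ‖a i - b i‖ := by
  induction s using Finset.induction_on with
  | empty => simp
  | insert c s hc ih =>
      rw [prod_insert hc, prod_insert hc, sum_insert hc]
      have hB : ‖∏ i ∈ s, b i‖ ≤ 1 := by
        rw [norm_prod]
        exact prod_le_one (fun i _ => norm_nonneg _) fun i hi => hb i (mem_insert_of_mem hi)
      have hih := ih (fun i hi => ha i (mem_insert_of_mem hi)) (fun i hi => hb i (mem_insert_of_mem hi))
      have hsplit : a c * ∏ i ∈ s, a i - b c * ∏ i ∈ s, b i =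
          a c * (∏ i ∈ s, a i - ∏ i ∈ s, b i) + (a c - b c) * ∏ i ∈ s, b i := by ring
      rw [hsplit]
      calc _ ≤ ‖a c * (∏ i ∈ s, a i - ∏ i ∈ s, b i)‖ + ‖(a c - b c) * ∏ i ∈ s, b i‖ := norm_add_le _ _
        _ = ‖a c‖ * ‖∏ i ∈ s, a i - ∏ i ∈ s, b i‖ + ‖a c - b c‖ * ‖∏ i ∈ s, b i‖ := by
            rw [norm_mul, norm_mul]
        _ ≤ 1 * ‖∏ i ∈ s, a i - ∏ i ∈ s, b i‖ + ‖a c - b c‖ * 1 := by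
            gcongr
            exact ha c (mem_insert_self c s)
        _ ≤ ‖a c - b c‖ + ∑ i ∈ s, ‖a i - b i‖ := by linarith

/-- For unimodular `G` and `ζ`: `∑_m ‖G m - ζ‖² = 2N - 2 Re(conj ζ ∑_m G m)` (Lemma 6.1 of
Konieczny 2020 in exact form). [cite: Konieczny2020, Lemma 6.1] -/
theorem sum_norm_sub_sq_eq (s : Finset ℕ) {G : ℕ → ℂ} (hG : ∀ m ∈ s, ‖G m‖ = 1) {ζ : ℂ}
    (hζ : ‖ζ‖ = 1) :
    ∑ m ∈ s, ‖G m - ζ‖ ^ 2 = 2 * #s - 2 * (conj ζ * ∑ m ∈ s, G m).re := by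
  have hterm : ∀ m ∈ s, ‖G m - ζ‖ ^ 2 = 2 - 2 * (conj ζ * G m).re := by
    intro m hm
    rw [← Complex.normSq_eq_norm_sq, Complex.normSq_sub, Complex.normSq_eq_norm_sq,
      Complex.normSq_eq_norm_sq, hG m hm, hζ, mul_comm (G m)]
    norm_num
  rw [sum_congr rfl hterm, sum_sub_distrib, sum_const, nsmul_eq_mul, mul_sum, Complex.re_sum,
    mul_sum]
  ring

/-- `2N - 2‖∑ G‖ ≤ ∑ ‖G - Z‖²` for unimodular `G`, `Z`. [cite: Konieczny2020, Lemma 6.1] -/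
theorem two_mul_card_sub_le_sum_norm_sub_sq (s : Finset ℕ) {G : ℕ → ℂ} (hG : ∀ m ∈ s, ‖G m‖ = 1)
    {Z : ℂ} (hZ : ‖Z‖ = 1) :
    2 * #s - 2 * ‖∑ m ∈ s, G m‖ ≤ ∑ m ∈ s, ‖G m - Z‖ ^ 2 := by
  rw [sum_norm_sub_sq_eq s hG hZ]
  have h : (conj Z * ∑ m ∈ s, G m).re ≤ ‖∑ m ∈ s, G m‖ := by
    refine (Complex.re_le_norm _).trans ?_
    rw [norm_mul, Complex.norm_conj, hZ, one_mul]
  linarith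

/-- There is a unimodular `ζ` with `∑ ‖G - ζ‖² = 2N - 2‖∑ G‖` (unimodular `G`).
[cite: Konieczny2020, Lemma 6.1] -/
theorem exists_sum_norm_sub_sq_eq (s : Finset ℕ) {G : ℕ → ℂ} (hG : ∀ m ∈ s, ‖G m‖ = 1) :
    ∃ ζ : ℂ, ‖ζ‖ = 1 ∧ ∑ m ∈ s, ‖G m - ζ‖ ^ 2 = 2 * #s - 2 * ‖∑ m ∈ s, G m‖ := by
  set w := ∑ m ∈ s, G m with hw
  by_cases h0 : w = 0
  · refine ⟨1, by simp, ?_⟩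
    rw [sum_norm_sub_sq_eq s hG (by simp), ← hw, h0]
    simp
  · have hwn : ‖w‖ ≠ 0 := norm_ne_zero_iff.2 h0
    have hwC : ((‖w‖ : ℝ) : ℂ) ≠ 0 := Complex.ofReal_ne_zero.2 hwn
    have h1 : ‖w / ‖w‖‖ = 1 := by
      rw [norm_div, Complex.norm_real, Real.norm_eq_abs, abs_norm, div_self hwn]
    refine ⟨w / ‖w‖, h1, ?_⟩
    have hre : (conj (w / ‖w‖) * w).re = ‖w‖ := by
      have : conj (w / ‖w‖) * w = ((‖w‖ : ℝ) : ℂ) := by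
        rw [map_div₀, Complex.conj_ofReal, div_mul_eq_mul_div, mul_comm (conj w) w,
          Complex.mul_conj, Complex.normSq_eq_norm_sq, div_eq_iff hwC]
        push_cast
        ring
      rw [this, Complex.ofReal_re]
    rw [sum_norm_sub_sq_eq s hG h1, ← hw, hre]

/-! ## Bookkeeping for the blocks -/

/-- The blocks with index `≡ a (mod 3)`: `{b < B : b % 3 = a} = {3j + a : j < (B - a + 2)/3}`.
[folklore] -/
theorem filter_mod_three_eq_image (B a : ℕ) (ha : a < 3) :
    (range B).filter (fun b => b % 3 = a) = (range ((B - a + 2) / 3)).image (fun j => 3 * j + a) := by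
  ext b
  simp only [mem_filter, mem_range, mem_image]
  constructor
  · rintro ⟨hb, hba⟩
    exact ⟨b / 3, by omega, by omega⟩
  · rintro ⟨j, hj, rfl⟩
    exact ⟨by omega, by omega⟩

/-- For `m < q^L` and `s ≤ L`, reducing the block `m / q^s` modulo `q^t` is the same as modulo
`q^{min t (L-s)}`. [folklore] -/
theorem div_mod_eq_mod_min {q L s t m : ℕ} (hq : 0 < q) (hm : m < q ^ L) (hs : s ≤ L) :
    m / q ^ s % q ^ t = m / q ^ s % q ^ (min t (L - s)) := by
  rcases le_total t (L - s) with h | h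
  · rw [min_eq_left h]
  · rw [min_eq_right h]
    have hlt : m / q ^ s < q ^ (L - s) := by
      rw [Nat.div_lt_iff_lt_mul (pow_pos hq s), ← pow_add, Nat.sub_add_cancel hs]; exact hm
    rw [Nat.mod_eq_of_lt (lt_of_lt_of_le hlt (Nat.pow_le_pow_right hq h)), Nat.mod_eq_of_lt hlt]

/-- Nonnegativity of window defects of a `1`-bounded sequence, summed. [folklore] -/
theorem sum_window_defect_nonneg {q : ℕ} (hq : 2 ≤ q) {f : ℕ → ℂ} (hf1 : ∀ n, ‖f n‖ ≤ 1)
    (s : Finset ℕ) (u : Finset ℕ) :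
    0 ≤ ∑ k ∈ s, ∑ l ∈ u, (1 - ‖∑ c ∈ range (q ^ l), f (c * q ^ k)‖ / (q : ℝ) ^ l) :=
  sum_nonneg fun k _ => sum_nonneg fun l _ => (window_defect_mem hq hf1 k l).1

/-! ## Proposition 6.3 -/

/-- **Konieczny 2020, Proposition 6.3** (window at position `0`; see `local_control`).
[cite: Konieczny2020, Proposition 6.3] -/
theorem local_control_zero {q r : ℕ} (hq : 2 ≤ q) (hr : 1 ≤ r) {F : ℕ → ℂ}
    (hF : IsSemimultiplicative q r F) (hF1 : ∀ n, ‖F n‖ = 1) (L : ℕ) :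
    1 - ‖∑ c ∈ range (q ^ L), F c‖ / (q : ℝ) ^ L ≤
      12 * ∑ k ∈ range L, ∑ l ∈ Icc 1 (2 * r),
        (1 - ‖∑ c ∈ range (q ^ l), F (c * q ^ k)‖ / (q : ℝ) ^ l) := by
  have hqpos : 0 < q := by omega
  have hq0 : (0 : ℝ) < q := by exact_mod_cast hqpos
  have hF1' : ∀ n, ‖F n‖ ≤ 1 := fun n => (hF1 n).le
  set S := ∑ k ∈ range L, ∑ l ∈ Icc 1 (2 * r),
    (1 - ‖∑ c ∈ range (q ^ l), F (c * q ^ k)‖ / (q : ℝ) ^ l) with hSdef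
  have hS0 : 0 ≤ S := sum_window_defect_nonneg hq hF1' _ _
  rcases Nat.eq_zero_or_pos L with hL0 | hL
  · subst hL0
    simp [hF.1]
    linarith
  -- the number of blocks `B = ⌈L/r⌉`, `(B-1) r < L ≤ B r`
  set B := (L + r - 1) / r with hB
  have hLB : L ≤ B * r := by
    have : ¬ (B < (L + r - 1) / r) := lt_irrefl _
    rw [lt_ceilDiv_iff hr B L] at this
    rw [mul_comm]; omega
  have hB1 : 1 ≤ B := by
    rw [hB, Nat.le_div_iff_mul_le hr]; omega
  obtain ⟨B', hB'⟩ : ∃ B', B = B' + 1 := ⟨B - 1, by omega⟩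
  have hBL : B' * r < L := by
    have : B' < (L + r - 1) / r := by rw [← hB]; omega
    rw [lt_ceilDiv_iff hr B' L] at this
    rw [mul_comm]; exact this
  set N : ℕ := q ^ L with hN
  have hNpos : (0 : ℝ) < N := by rw [hN]; positivity
  have hmL : ∀ m ∈ range N, m < q ^ ((B' + 1) * r) := by
    intro m hm
    rw [mem_range] at hm
    exact lt_of_lt_of_le hm (Nat.pow_le_pow_right hqpos (by rw [← hB']; exact hLB))
  -- the block functions
  set pair : ℕ → ℕ → ℂ := fun b m => F ((m / q ^ (b * r) % q ^ (2 * r)) * q ^ (b * r)) with hpair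
  set sing : ℕ → ℕ → ℂ := fun b m => if b = 0 then 1 else F ((m / q ^ (b * r) % q ^ r) * q ^ (b * r))
    with hsing
  have hpair1 : ∀ b m, ‖pair b m‖ = 1 := fun b m => hF1 _
  have hsing1 : ∀ b m, ‖sing b m‖ = 1 := by
    intro b m; simp only [hsing]; split_ifs <;> simp [hF1]
  set P : ℕ → ℕ → ℂ := fun a m => ∏ b ∈ (range B).filter (fun b => b % 3 = a), pair b m with hP
  set Q : ℕ → ℕ → ℂ := fun a m => ∏ b ∈ (range B).filter (fun b => b % 3 = a), sing b m with hQ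
  have hP1 : ∀ a m, ‖P a m‖ = 1 := by
    intro a m; simp only [hP, norm_prod, hpair1, prod_const_one]
  have hQ1 : ∀ a m, ‖Q a m‖ = 1 := by
    intro a m; simp only [hQ, norm_prod, hsing1, prod_const_one]
  -- the chain identity in grouped form: `F m = (∏_a P a m) conj (∏_a Q a m)`
  have hchain : ∀ m ∈ range N, F m = (∏ a ∈ range 3, P a m) * conj (∏ a ∈ range 3, Q a m) := by
    intro m hm
    have h := chain_identity hq B' hF hF1 m (hmL m hm)
    rw [← hB'] at h
    have hfibP : ∏ a ∈ range 3, P a m = ∏ b ∈ range B, pair b m :=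
      prod_fiberwise_of_maps_to (fun b _ => mem_range.2 (Nat.mod_lt b (by norm_num))) _
    have hfibQ : ∏ a ∈ range 3, Q a m = ∏ b ∈ range B, sing b m :=
      prod_fiberwise_of_maps_to (fun b _ => mem_range.2 (Nat.mod_lt b (by norm_num))) _
    rw [hfibP, hfibQ]
    have hsingprod : ∏ b ∈ range B, F ((m / q ^ (b * r) % q ^ r) * q ^ (b * r)) =
        F (m % q ^ r) * ∏ b ∈ range B, sing b m := by
      have : ∀ b ∈ range B, F ((m / q ^ (b * r) % q ^ r) * q ^ (b * r)) =
          sing b m * (if b = 0 then F (m % q ^ r) else 1) := by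
        intro b _
        simp only [hsing]
        split_ifs with hb
        · subst hb; simp
        · simp
      rw [prod_congr rfl this, prod_mul_distrib, prod_ite_eq', if_pos (mem_range.2 (by omega)),
        mul_comm]
    rw [h, hsingprod, map_mul]
    have hu : F (m % q ^ r) * conj (F (m % q ^ r)) = 1 := mul_conj_eq_one_of_norm (hF1 _)
    simp only [hpair]
    linear_combination (∏ b ∈ range B, F ((m / q ^ (b * r) % q ^ (2 * r)) * q ^ (b * r))) *
      conj (∏ b ∈ range B, sing b m) * hu
  -- optimal constants
  have hoptP := fun a => exists_sum_norm_sub_sq_eq (range N) (G := P a) (fun m _ => hP1 a m)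
  have hoptQ := fun a => exists_sum_norm_sub_sq_eq (range N) (G := Q a) (fun m _ => hQ1 a m)
  choose ζ hζ1 hζ using hoptP
  choose ξ hξ1 hξ using hoptQ
  set Z : ℂ := (∏ a ∈ range 3, ζ a) * conj (∏ a ∈ range 3, ξ a) with hZ
  have hζprod : ‖∏ a ∈ range 3, ζ a‖ = 1 := by rw [norm_prod]; simp [hζ1]
  have hξprod : ‖∏ a ∈ range 3, ξ a‖ = 1 := by rw [norm_prod]; simp [hξ1]
  have hZ1 : ‖Z‖ = 1 := by rw [hZ, norm_mul, Complex.norm_conj, hζprod, hξprod, one_mul]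
  -- pointwise: `‖F m - Z‖ ≤ ∑_a ‖P a m - ζ a‖ + ∑_a ‖Q a m - ξ a‖`
  have hpt : ∀ m ∈ range N, ‖F m - Z‖ ^ 2 ≤
      6 * ∑ a ∈ range 3, (‖P a m - ζ a‖ ^ 2 + ‖Q a m - ξ a‖ ^ 2) := by
    intro m hm
    have h1 : ‖F m - Z‖ ≤ ∑ a ∈ range 3, ‖P a m - ζ a‖ + ∑ a ∈ range 3, ‖Q a m - ξ a‖ := by
      rw [hchain m hm, hZ]
      set x := ∏ a ∈ range 3, P a m
      set y := conj (∏ a ∈ range 3, Q a m)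
      set z := ∏ a ∈ range 3, ζ a
      set w := conj (∏ a ∈ range 3, ξ a)
      have hy : ‖y‖ = 1 := by simp only [y, Complex.norm_conj, norm_prod, hQ1, prod_const_one]
      have hsplit : x * y - z * w = (x - z) * y + z * (y - w) := by ring
      calc ‖x * y - z * w‖ = ‖(x - z) * y + z * (y - w)‖ := by rw [hsplit]
        _ ≤ ‖x - z‖ * ‖y‖ + ‖z‖ * ‖y - w‖ := by
            refine (norm_add_le _ _).trans ?_; rw [norm_mul, norm_mul]
        _ = ‖x - z‖ + ‖y - w‖ := by rw [hy, hζprod, mul_one, one_mul]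
        _ ≤ _ := by
            refine add_le_add ?_ ?_
            · exact norm_prod_sub_prod_le _ _ _ (fun a _ => (hP1 a m).le) (fun a _ => (hζ1 a).le)
            · simp only [y, w, ← map_sub, Complex.norm_conj]
              exact norm_prod_sub_prod_le _ _ _ (fun a _ => (hQ1 a m).le) (fun a _ => (hξ1 a).le)
    have h2 : (∑ a ∈ range 3, ‖P a m - ζ a‖ + ∑ a ∈ range 3, ‖Q a m - ξ a‖) ^ 2 ≤
        6 * ∑ a ∈ range 3, (‖P a m - ζ a‖ ^ 2 + ‖Q a m - ξ a‖ ^ 2) := by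
      rw [← sum_add_distrib]
      have hCS := sum_mul_sq_le_sq_mul_sq (range 3) (fun _ => (1 : ℝ))
        (fun a => ‖P a m - ζ a‖ + ‖Q a m - ξ a‖)
      simp only [one_mul, one_pow, sum_const, card_range, nsmul_eq_mul, mul_one] at hCS
      have h3 : ∀ a ∈ range 3, (‖P a m - ζ a‖ + ‖Q a m - ξ a‖) ^ 2 ≤
          2 * (‖P a m - ζ a‖ ^ 2 + ‖Q a m - ξ a‖ ^ 2) := by
        intro a _
        nlinarith [sq_nonneg (‖P a m - ζ a‖ - ‖Q a m - ξ a‖)]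
      calc _ ≤ (3 : ℝ) * ∑ a ∈ range 3, (‖P a m - ζ a‖ + ‖Q a m - ξ a‖) ^ 2 := by
            exact_mod_cast hCS
        _ ≤ 3 * ∑ a ∈ range 3, 2 * (‖P a m - ζ a‖ ^ 2 + ‖Q a m - ξ a‖ ^ 2) := by
            gcongr with a ha
            exact h3 a ha
        _ = _ := by rw [← mul_sum]; ring
    calc ‖F m - Z‖ ^ 2 ≤ (∑ a ∈ range 3, ‖P a m - ζ a‖ + ∑ a ∈ range 3, ‖Q a m - ξ a‖) ^ 2 := by
          gcongr
      _ ≤ _ := h2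
  -- sum over `m`
  have hsum : 2 * (N : ℝ) - 2 * ‖∑ m ∈ range N, F m‖ ≤
      12 * ∑ a ∈ range 3, (((N : ℝ) - ‖∑ m ∈ range N, P a m‖) + ((N : ℝ) - ‖∑ m ∈ range N, Q a m‖)) := by
    have h1 := two_mul_card_sub_le_sum_norm_sub_sq (range N) (G := F) (fun m _ => hF1 m) hZ1
    rw [card_range] at h1
    refine h1.trans ?_
    calc ∑ m ∈ range N, ‖F m - Z‖ ^ 2
        ≤ ∑ m ∈ range N, 6 * ∑ a ∈ range 3, (‖P a m - ζ a‖ ^ 2 + ‖Q a m - ξ a‖ ^ 2) :=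
          sum_le_sum hpt
      _ = 6 * ∑ a ∈ range 3, (∑ m ∈ range N, ‖P a m - ζ a‖ ^ 2 + ∑ m ∈ range N, ‖Q a m - ξ a‖ ^ 2) := by
          rw [← mul_sum, sum_comm]
          simp only [sum_add_distrib]
      _ = 6 * ∑ a ∈ range 3, ((2 * N - 2 * ‖∑ m ∈ range N, P a m‖) +
            (2 * N - 2 * ‖∑ m ∈ range N, Q a m‖)) := by
          congr 1
          refine sum_congr rfl fun a _ => ?_
          rw [hζ a, hξ a, card_range]
      _ = _ := by rw [mul_sum, mul_sum]; refine sum_congr rfl fun a _ => ?_; ring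
  -- independence: evaluate the averages of `P a` and `Q a`
  have hPavg : ∀ a ∈ range 3, (N : ℝ) - ‖∑ m ∈ range N, P a m‖ ≤
      N * ∑ b ∈ (range B).filter (fun b => b % 3 = a), ∑ l ∈ Icc 1 (2 * r),
        (1 - ‖∑ c ∈ range (q ^ l), F (c * q ^ (b * r))‖ / (q : ℝ) ^ l) := by
    intro a ha
    rw [mem_range] at ha
    set J := (B - a + 2) / 3 with hJ
    set s : ℕ → ℕ := fun j => (3 * j + a) * r with hs
    set t : ℕ → ℕ := fun j => min (2 * r) (L - s j) with ht
    have hchainst : ∀ j, s j + t j ≤ s (j + 1) := by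
      intro j; simp only [hs, ht]
      have : min (2 * r) (L - (3 * j + a) * r) ≤ 2 * r := min_le_left _ _
      nlinarith
    have hsL : ∀ j < J, s j < L := by
      intro j hj
      simp only [hs]
      have : 3 * j + a ≤ B' := by omega
      calc (3 * j + a) * r ≤ B' * r := Nat.mul_le_mul_right r this
        _ < L := hBL
    have htop : ∀ j < J, s j + t j ≤ L := by
      intro j hj; simp only [ht]; have := hsL j hj; omega
    have himg := filter_mod_three_eq_image B a ha
    have hinj : Set.InjOn (fun j => 3 * j + a) (range J : Set ℕ) := fun x _ y _ h => by
      simp only at h; omega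
    -- `P a m` as a product over `j < J` of block functions
    set φ : ℕ → ℕ → ℂ := fun j c => F (c * q ^ s j) with hφ
    have hPφ : ∀ m ∈ range N, P a m = ∏ j ∈ range J, φ j (m / q ^ s j % q ^ t j) := by
      intro m hm
      rw [mem_range] at hm
      simp only [hP]
      rw [himg, prod_image hinj]
      refine prod_congr rfl fun j hj => ?_
      rw [mem_range] at hj
      simp only [hpair, hφ, hs, ht]
      rw [div_mod_eq_mod_min hqpos hm (hsL j hj).le]
    have hind := avg_prod_blocks hq s t hchainst φ J L htop
    have hsumP : ∑ m ∈ range N, P a m = ∑ m ∈ range N, ∏ j ∈ range J, φ j (m / q ^ s j % q ^ t j) :=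
      sum_congr rfl hPφ
    -- norms of the window averages
    set W : ℕ → ℂ := fun j => ((q : ℂ) ^ t j)⁻¹ * ∑ c ∈ range (q ^ t j), φ j c with hW
    have hW1 : ∀ j, ‖W j‖ = ‖∑ c ∈ range (q ^ t j), F (c * q ^ s j)‖ / (q : ℝ) ^ t j := by
      intro j
      simp only [hW, hφ, norm_mul, norm_inv, norm_pow, Complex.norm_natCast]
      rw [div_eq_inv_mul]
    have hW01 : ∀ j, 0 ≤ ‖W j‖ ∧ ‖W j‖ ≤ 1 := by
      intro j
      have := window_defect_mem hq hF1' (s j) (t j)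
      rw [hW1]; constructor <;> linarith [this.1, this.2]
    have havg : ‖∑ m ∈ range N, P a m‖ = N * ∏ j ∈ range J, ‖W j‖ := by
      have : ∑ m ∈ range N, P a m = (N : ℂ) * ∏ j ∈ range J, W j := by
        rw [hsumP, ← hind, hN]
        push_cast
        rw [← mul_assoc, mul_inv_cancel₀ (pow_ne_zero L (by exact_mod_cast hqpos.ne')), one_mul]
      rw [this, norm_mul, Complex.norm_natCast, norm_prod]
    rw [havg, ← mul_one_sub, himg, sum_image hinj]
    refine mul_le_mul_of_nonneg_left ?_ hNpos.le
    refine (one_sub_prod_le_sum (range J) (fun j => ‖W j‖) (fun j _ => (hW01 j).1)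
      (fun j _ => (hW01 j).2)).trans (sum_le_sum fun j hj => ?_)
    rw [mem_range] at hj
    rw [hW1]
    have htj : t j ∈ Icc 1 (2 * r) := by
      rw [mem_Icc]; simp only [ht]; have := hsL j hj; omega
    exact single_le_sum (f := fun l => 1 - ‖∑ c ∈ range (q ^ l), F (c * q ^ s j)‖ / (q : ℝ) ^ l)
      (fun l _ => (window_defect_mem hq hF1' (s j) l).1) htj
  have hQavg : ∀ a ∈ range 3, (N : ℝ) - ‖∑ m ∈ range N, Q a m‖ ≤
      N * ∑ b ∈ (range B).filter (fun b => b % 3 = a), ∑ l ∈ Icc 1 (2 * r),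
        (1 - ‖∑ c ∈ range (q ^ l), F (c * q ^ (b * r))‖ / (q : ℝ) ^ l) := by
    intro a ha
    rw [mem_range] at ha
    set J := (B - a + 2) / 3 with hJ
    set s : ℕ → ℕ := fun j => (3 * j + a) * r with hs
    set t : ℕ → ℕ := fun j => min r (L - s j) with ht
    have hchainst : ∀ j, s j + t j ≤ s (j + 1) := by
      intro j; simp only [hs, ht]
      have : min r (L - (3 * j + a) * r) ≤ r := min_le_left _ _
      nlinarith
    have hsL : ∀ j < J, s j < L := by
      intro j hj
      simp only [hs]
      have : 3 * j + a ≤ B' := by omega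
      calc (3 * j + a) * r ≤ B' * r := Nat.mul_le_mul_right r this
        _ < L := hBL
    have htop : ∀ j < J, s j + t j ≤ L := by
      intro j hj; simp only [ht]; have := hsL j hj; omega
    have himg := filter_mod_three_eq_image B a ha
    have hinj : Set.InjOn (fun j => 3 * j + a) (range J : Set ℕ) := fun x _ y _ h => by
      simp only at h; omega
    set φ : ℕ → ℕ → ℂ := fun j c => if 3 * j + a = 0 then 1 else F (c * q ^ s j) with hφ
    have hQφ : ∀ m ∈ range N, Q a m = ∏ j ∈ range J, φ j (m / q ^ s j % q ^ t j) := by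
      intro m hm
      rw [mem_range] at hm
      simp only [hQ]
      rw [himg, prod_image hinj]
      refine prod_congr rfl fun j hj => ?_
      rw [mem_range] at hj
      simp only [hsing, hφ, hs, ht]
      split_ifs
      · rfl
      · rw [div_mod_eq_mod_min hqpos hm (hsL j hj).le]
    have hind := avg_prod_blocks hq s t hchainst φ J L htop
    have hsumQ : ∑ m ∈ range N, Q a m = ∑ m ∈ range N, ∏ j ∈ range J, φ j (m / q ^ s j % q ^ t j) :=
      sum_congr rfl hQφ
    set W : ℕ → ℂ := fun j => ((q : ℂ) ^ t j)⁻¹ * ∑ c ∈ range (q ^ t j), φ j c with hW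
    have hW1 : ∀ j, ‖W j‖ = if 3 * j + a = 0 then 1 else
        ‖∑ c ∈ range (q ^ t j), F (c * q ^ s j)‖ / (q : ℝ) ^ t j := by
      intro j
      simp only [hW, hφ]
      split_ifs with h0
      · simp only [sum_const, card_range, nsmul_eq_mul, mul_one]
        push_cast
        rw [inv_mul_cancel₀ (pow_ne_zero _ (by exact_mod_cast hqpos.ne')), norm_one]
      · simp only [norm_mul, norm_inv, norm_pow, Complex.norm_natCast]
        rw [div_eq_inv_mul]
    have hW01 : ∀ j, 0 ≤ ‖W j‖ ∧ ‖W j‖ ≤ 1 := by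
      intro j
      have := window_defect_mem hq hF1' (s j) (t j)
      rw [hW1]; split_ifs
      · norm_num
      · constructor <;> linarith [this.1, this.2]
    have havg : ‖∑ m ∈ range N, Q a m‖ = N * ∏ j ∈ range J, ‖W j‖ := by
      have : ∑ m ∈ range N, Q a m = (N : ℂ) * ∏ j ∈ range J, W j := by
        rw [hsumQ, ← hind, hN]
        push_cast
        rw [← mul_assoc, mul_inv_cancel₀ (pow_ne_zero L (by exact_mod_cast hqpos.ne')), one_mul]
      rw [this, norm_mul, Complex.norm_natCast, norm_prod]
    rw [havg, ← mul_one_sub, himg, sum_image hinj]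
    refine mul_le_mul_of_nonneg_left ?_ hNpos.le
    refine (one_sub_prod_le_sum (range J) (fun j => ‖W j‖) (fun j _ => (hW01 j).1)
      (fun j _ => (hW01 j).2)).trans (sum_le_sum fun j hj => ?_)
    rw [mem_range] at hj
    rw [hW1]
    split_ifs
    · rw [sub_self]
      exact sum_nonneg fun l _ => (window_defect_mem hq hF1' _ l).1
    · have htj : t j ∈ Icc 1 (2 * r) := by
        rw [mem_Icc]; simp only [ht]; have := hsL j hj; omega
      exact single_le_sum (f := fun l => 1 - ‖∑ c ∈ range (q ^ l), F (c * q ^ s j)‖ / (q : ℝ) ^ l)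
        (fun l _ => (window_defect_mem hq hF1' (s j) l).1) htj
  -- the sums over the blocks are bounded by `S`
  have hblocks : ∑ b ∈ range B, ∑ l ∈ Icc 1 (2 * r),
      (1 - ‖∑ c ∈ range (q ^ l), F (c * q ^ (b * r))‖ / (q : ℝ) ^ l) ≤ S := by
    have hinj : Set.InjOn (fun b => b * r) (range B : Set ℕ) := fun x _ y _ h => by
      simp only at h; exact Nat.eq_of_mul_eq_mul_right hr h
    rw [hSdef, ← sum_image (f := fun k => ∑ l ∈ Icc 1 (2 * r),
      (1 - ‖∑ c ∈ range (q ^ l), F (c * q ^ k)‖ / (q : ℝ) ^ l)) hinj]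
    refine sum_le_sum_of_subset_of_nonneg ?_ (fun k _ _ =>
      sum_nonneg fun l _ => (window_defect_mem hq hF1' k l).1)
    intro k hk
    rw [mem_image] at hk
    obtain ⟨b, hb, rfl⟩ := hk
    rw [mem_range] at hb ⊢
    calc b * r ≤ B' * r := Nat.mul_le_mul_right r (by omega)
      _ < L := hBL
  have hfibP : ∑ a ∈ range 3, ∑ b ∈ (range B).filter (fun b => b % 3 = a), ∑ l ∈ Icc 1 (2 * r),
      (1 - ‖∑ c ∈ range (q ^ l), F (c * q ^ (b * r))‖ / (q : ℝ) ^ l) =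
      ∑ b ∈ range B, ∑ l ∈ Icc 1 (2 * r),
        (1 - ‖∑ c ∈ range (q ^ l), F (c * q ^ (b * r))‖ / (q : ℝ) ^ l) :=
    sum_fiberwise_of_maps_to (fun b _ => mem_range.2 (Nat.mod_lt b (by norm_num))) _
  -- conclusion
  have hfinal : 2 * (N : ℝ) - 2 * ‖∑ m ∈ range N, F m‖ ≤ 12 * (N * S + N * S) := by
    refine hsum.trans ?_
    refine mul_le_mul_of_nonneg_left ?_ (by norm_num)
    calc ∑ a ∈ range 3, (((N : ℝ) - ‖∑ m ∈ range N, P a m‖) + ((N : ℝ) - ‖∑ m ∈ range N, Q a m‖))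
        ≤ ∑ a ∈ range 3, (N * ∑ b ∈ (range B).filter (fun b => b % 3 = a), ∑ l ∈ Icc 1 (2 * r),
            (1 - ‖∑ c ∈ range (q ^ l), F (c * q ^ (b * r))‖ / (q : ℝ) ^ l) +
          N * ∑ b ∈ (range B).filter (fun b => b % 3 = a), ∑ l ∈ Icc 1 (2 * r),
            (1 - ‖∑ c ∈ range (q ^ l), F (c * q ^ (b * r))‖ / (q : ℝ) ^ l)) :=
          sum_le_sum fun a ha => add_le_add (hPavg a ha) (hQavg a ha)
      _ = N * ∑ b ∈ range B, ∑ l ∈ Icc 1 (2 * r),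
            (1 - ‖∑ c ∈ range (q ^ l), F (c * q ^ (b * r))‖ / (q : ℝ) ^ l) +
          N * ∑ b ∈ range B, ∑ l ∈ Icc 1 (2 * r),
            (1 - ‖∑ c ∈ range (q ^ l), F (c * q ^ (b * r))‖ / (q : ℝ) ^ l) := by
          rw [sum_add_distrib, ← mul_sum, hfibP]
      _ ≤ N * S + N * S := by gcongr
  have hNeq : ((q : ℝ) ^ L) = N := by rw [hN]; push_cast; ring
  have hsig : (N : ℝ) - ‖∑ m ∈ range N, F m‖ ≤ 12 * S * N := by nlinarith [hfinal]
  rw [hNeq]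
  have hdiv : 1 - ‖∑ m ∈ range N, F m‖ / (N : ℝ) = ((N : ℝ) - ‖∑ m ∈ range N, F m‖) / N := by
    field_simp
  rw [hdiv, div_le_iff₀ hNpos]
  exact hsig

/-- **Konieczny 2020, Proposition 6.3** (global cancellation is controlled locally).  Let `f` be
unimodular and `q`-semimultiplicative with gap `≤ r`, `r ≥ 1`, and let `[K, K+L)` be a window of
digit positions.  Then, with `δ_{k,l}(f) = 1 - ‖∑_{c<q^l} f(c q^k)‖/q^l`,
`δ_{K,L}(f) ≤ 12 ∑_{K ≤ k < K+L} ∑_{1 ≤ l ≤ 2r} δ_{k,l}(f)`.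
The paper states: `ε_f^I ≪ ∑_i ε_f^{I_i}` for suitable disjoint sub-intervals `I_i ⊆ I` of
length `≤ 2r` (`ε = -log λ`); here the sum is over all sub-windows of length `≤ 2r`, all terms
being nonnegative. [cite: Konieczny2020, Proposition 6.3] -/
theorem local_control {q r : ℕ} (hq : 2 ≤ q) (hr : 1 ≤ r) {f : ℕ → ℂ}
    (hf : IsSemimultiplicative q r f) (hf1 : ∀ n, ‖f n‖ = 1) (K L : ℕ) :
    1 - ‖∑ c ∈ range (q ^ L), f (c * q ^ K)‖ / (q : ℝ) ^ L ≤
      12 * ∑ k ∈ Ico K (K + L), ∑ l ∈ Icc 1 (2 * r),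
        (1 - ‖∑ c ∈ range (q ^ l), f (c * q ^ k)‖ / (q : ℝ) ^ l) := by
  have h := local_control_zero hq hr (dilate hq hf K) (fun n => hf1 _) L
  simp only [mul_assoc, ← pow_add] at h
  rw [sum_Ico_eq_sum_range, Nat.add_sub_cancel_left]
  simpa only [add_comm] using h

end Konieczny

end Literature.NumberTheory.LFunctions
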